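import Literature.Geometry.Riemannian.LieDerivMetricChart
import Literature.Geometry.Manifold.TimeDependentIntegralCurve
import Mathlib.Analysis.Calculus.FDeriv.Symmetric
import HarnessLib

/-!
# The time derivative of a pulled-back family of metrics (Topping 2006, Prop. 1.2.1)
(topic `Geometry/Riemannian`)

Support file (everything proved, no named fact) for the existence direction of DeTurck's trick
(Topping 2006, §5.2, Step 2 (iv); DeTurck 1983): **Topping's Proposition 1.2.1** with `σ ≡ 1`,

  `∂/∂t (ψ_t^* g_t) = ψ_t^* (∂g_t/∂t + ℒ_{X_t} g_t)`,                                    (1.2.3)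

for a smooth one-parameter family of metrics `g_t` on `M`, a time-dependent vector field `X_t`
on `M` and a family of maps `ψ_t : N → M` with `∂ψ_t/∂t = X_t ∘ ψ_t` ("`X(t)` generating `ψ_t`",
(1.2.1)), in the pointwise form used by the tree's `IsRicciFlow` / `IsRicciDeTurckFlow`
(`RicciFlow.lean`, `RicciDeTurckFlow.lean`): for `u ∈ N` and `v, w ∈ T_u N`, the real function
`t ↦ (ψ_t^* g_t)_u(v, w) = g_t(ψ_t u)(dψ_t v, dψ_t w)` has derivative

  `(∂_t g_t)(ψ_t u)(dψ_t v, dψ_t w) + (ℒ_{X_t} g_t)(ψ_t u)(dψ_t v, dψ_t w)`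

at `t₀` **within the time set `S`** (one-sided at an initial time: the DeTurck argument needs the
formula at `t = 0` of `[0, ε]`, which is why everything here is done with derivatives within
`S` and not with the two-sided calculus of vector fields along curves), where
`ℒ_X g (A, B) = g(∇_A X, B) + g(A, ∇_B X)` is `lieDerivMetric` (`RicciDeTurckFlow.lean`; Topping
2006, (2.3.8)) for a Levi-Civita connection `∇` of `g_{t₀}`. This is
`hasDerivWithinAt_val_pullback_family`.

*Proof* ("This follows from the definition of the Lie derivative", Topping p. 24; here in a chart,
as no flow-based Lie derivative of tensors is available). Read everything in the chart `φ` of `M`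
at `x₀ = ψ_{t₀} u` and the chart of `N` at `u` (`LieDerivMetricChart.lean`): the function is
`t ↦ Ĝ(φ(γ t), t)(V̂ t, Ŵ t)` with `γ t = ψ_t u`, `Ĝ` the family read in the chart
(`IsContMDiffFamilyOn.contDiffOn_metricInChart`: `C^∞` on `φ.target × S`), and
`V̂ t = τ_{γ t}(dψ_t v)` the `u`-partial derivative of the chart expression `Ψ̂` of `(u, t) ↦ ψ_t u`
(`continuousLinearMapAt_mfderiv_eq_fderiv`). By the chain and product rules within `S` its
derivative is `∂_tĜ(V̂, Ŵ) + D_zĜ[X̂](V̂, Ŵ) + Ĝ(V̂', Ŵ) + Ĝ(V̂, Ŵ')`, where `φ(γ t)' = X̂_t(φ(γ t))`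
is the integral-curve equation in the chart and — the one analytic point — `V̂' = DX̂_{t₀} V̂` by
the symmetry of second derivatives of `Ψ̂` *within* `(chart ball) × S`
(Mathlib's `ContDiffWithinAt.isSymmSndFDerivWithinAt`, valid at boundary points of `S` in the
closure of its interior; `hasDerivWithinAt_fderiv_slice`), i.e. `D_t ∂_u ψ = ∂_u ∂_t ψ =
∂_u (X ∘ ψ)` (the symmetry lemma, O'Neill 1983, Ch. 4, Prop. 4.44 (1), in coordinates). The last
three terms are `ℒ_{X_{t₀}} g_{t₀}` at `x₀` by the coordinate formula `lieDerivMetric_eq_chart`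
(`LieDerivMetricChart.lean`; O'Neill 1983, Ch. 9, proof of Prop. 9.25), and `∂_tĜ(V̂, Ŵ)` is the
prescribed time derivative `h` of the family by uniqueness of one-sided derivatives within `S`.

Also proved here, for the same data: **the pulled-back family `t ↦ ψ_t^* g_t` is smooth jointly
in space and time** on `N × S` (`IsContMDiffFamilyOn.pullbackBilin`, the parametric form of
`contMDiff_pullbackBilin_holds`, `IsometryProofs.lean`).

## References

* P. Topping, *Lectures on the Ricci flow*, LMS LNS 325 (2006), §1.2.2, (1.2.1)–(1.2.3) and
  Prop. 1.2.1 (p. 24); §2.3, (2.3.8); §5.2, Step 2 (i)–(iv) (p. 45). [Topping2006]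
* D. M. DeTurck, *Deforming metrics in the direction of their Ricci tensors*, J. Differential
  Geom. 18 (1983) 157–162. [DeTurck1983]
* B. O'Neill, *Semi-Riemannian geometry with applications to relativity* (1983), Ch. 4,
  Prop. 4.44 (1) (`x_{uv} = x_{vu}`); Ch. 9, Prop. 9.25. [ONeill1983]
* J. M. Lee, *Introduction to Smooth Manifolds*, 2nd ed. (2012), Ch. 9, pp. 236–237
  (time-dependent vector fields and their flows). [Lee2012]
-/

noncomputable section

open Bundle Set Filter Function
open scoped Manifold ContDiff Topology

namespace Literature.Geometry.Riemannian

open Lorentzian Lorentzian.PseudoRiemannianMetric Literature.Geometry.Manifold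

/-! ### Calculus: the `u`-derivative of a solution of `∂_t Ψ = Y ∘ Ψ` evolves by `DY` -/

section Calculus

variable {F₁ : Type*} [NormedAddCommGroup F₁] [NormedSpace ℝ F₁]
  {F₂ : Type*} [NormedAddCommGroup F₂] [NormedSpace ℝ F₂]

/-- A boundary point of `S` in the closure of the interior of `S` stays so after intersecting
`S` with an open neighbourhood. [folklore] -/
theorem mem_closure_interior_inter {S J : Set ℝ} {t₀ : ℝ} (ht₀ : t₀ ∈ closure (interior S))
    (hJ : IsOpen J) (hJt : t₀ ∈ J) : t₀ ∈ closure (interior (S ∩ J)) := by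
  rw [interior_inter, hJ.interior_eq]
  rw [mem_closure_iff_nhds] at ht₀ ⊢
  intro U hU
  obtain ⟨s, hs⟩ := ht₀ (U ∩ J) (inter_mem hU (hJ.mem_nhds hJt))
  exact ⟨s, hs.1.1, hs.2, hs.1.2⟩

/-- **Symmetry of second derivatives within `B × S'` for a solution of `∂_t Ψ(u, t₀) = Y(Ψ(u, t₀))`.**
Let `Ψ : F₁ × ℝ → F₂` be `C²` on `B × S'` (`B` open, `S'` a set of unique differentiability,
`t₀ ∈ S'` in the closure of the interior of `S'` — e.g. an endpoint of an interval), suppose that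
for every `u ∈ B` the curve `t ↦ Ψ(u, t)` has derivative `Y(Ψ(u, t₀))` at `t₀` within `S'`, and
that `Y` is differentiable at `Ψ(u₀, t₀)`. Then the partial derivative
`t ↦ ∂_u Ψ(u₀, t) v` has derivative `DY(Ψ(u₀, t₀)) (∂_u Ψ(u₀, t₀) v)` at `t₀` within `S'`:
`∂_t ∂_u Ψ = ∂_u ∂_t Ψ = ∂_u (Y ∘ Ψ) = DY ∘ ∂_u Ψ` (Schwarz within `B × S'`, Mathlib's
`ContDiffWithinAt.isSymmSndFDerivWithinAt`; the coordinate form of the symmetry lemma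
`x_{tu} = x_{ut}`, O'Neill 1983, Ch. 4, Prop. 4.44 (1), for the two-parameter map `Ψ`).
[cite: ONeill1983, Ch. 4, Prop. 4.44 (1)] -/
theorem hasDerivWithinAt_fderiv_slice {Ψ : F₁ × ℝ → F₂} {Y : F₂ → F₂} {B : Set F₁} {S' : Set ℝ}
    {u₀ : F₁} {t₀ : ℝ} (hB : IsOpen B) (hu₀ : u₀ ∈ B) (hS' : UniqueDiffOn ℝ S') (ht₀ : t₀ ∈ S')
    (ht₀' : t₀ ∈ closure (interior S')) (hΨ : ContDiffOn ℝ 2 Ψ (B ×ˢ S'))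
    (hode : ∀ u ∈ B, HasDerivWithinAt (fun t ↦ Ψ (u, t)) (Y (Ψ (u, t₀))) S' t₀)
    (hY : DifferentiableAt ℝ Y (Ψ (u₀, t₀))) (v : F₁) :
    HasDerivWithinAt (fun t ↦ fderiv ℝ (fun u ↦ Ψ (u, t)) u₀ v)
      (fderiv ℝ Y (Ψ (u₀, t₀)) (fderiv ℝ (fun u ↦ Ψ (u, t₀)) u₀ v)) S' t₀ := by
  set Q : Set (F₁ × ℝ) := B ×ˢ S' with hQ_def
  have hQ : UniqueDiffOn ℝ Q := hB.uniqueDiffOn.prod hS'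
  have hp₀ : (u₀, t₀) ∈ Q := mk_mem_prod hu₀ ht₀
  -- the first derivative field of `Ψ` within `Q`, and its derivative at `(u₀, t₀)`
  have hD : ∀ p ∈ Q, HasFDerivWithinAt Ψ (fderivWithin ℝ Ψ Q p) Q p := fun p hp ↦
    (hΨ.differentiableOn (by simp) p hp).hasFDerivWithinAt
  set D2 := fderivWithin ℝ (fderivWithin ℝ Ψ Q) Q (u₀, t₀) with hD2_def
  have hD2 : HasFDerivWithinAt (fderivWithin ℝ Ψ Q) D2 Q (u₀, t₀) :=
    ((hΨ.fderivWithin hQ (m := 1) (by norm_num)).differentiableOn (by simp) (u₀, t₀)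
      hp₀).hasFDerivWithinAt
  have hsymm : IsSymmSndFDerivWithinAt ℝ Ψ Q (u₀, t₀) := by
    refine (hΨ (u₀, t₀) hp₀).isSymmSndFDerivWithinAt ?_ hQ ?_ hp₀
    · rw [minSmoothness_of_isRCLikeNormedField]
    · rw [hQ_def, interior_prod_eq, hB.interior_eq, closure_prod_eq]
      exact ⟨subset_closure hu₀, ht₀'⟩
  -- slices: `t ↦ Ψ(u, t)` and `u ↦ Ψ(u, t)`
  have hslice_t : ∀ u ∈ B, ∀ t ∈ S',
      HasDerivWithinAt (fun s ↦ Ψ (u, s)) (fderivWithin ℝ Ψ Q (u, t) ((0 : F₁), (1 : ℝ))) S' t := by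
    intro u hu t ht
    have hc : HasDerivWithinAt (fun s : ℝ ↦ (u, s)) ((0 : F₁), (1 : ℝ)) S' t :=
      (hasDerivWithinAt_const _ _ _).prodMk (hasDerivWithinAt_id _ _)
    exact (hD (u, t) (mk_mem_prod hu ht)).comp_hasDerivWithinAt t hc (fun s hs ↦ mk_mem_prod hu hs)
  have hslice_u : ∀ u ∈ B, ∀ t ∈ S', HasFDerivAt (fun w ↦ Ψ (w, t))
      ((fderivWithin ℝ Ψ Q (u, t)).comp (ContinuousLinearMap.inl ℝ F₁ ℝ)) u := by
    intro u hu t ht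
    have hc : HasFDerivWithinAt (fun w : F₁ ↦ (w, t)) (ContinuousLinearMap.inl ℝ F₁ ℝ) B u :=
      (hasFDerivAt_prodMk_left u t).hasFDerivWithinAt
    have h := (hD (u, t) (mk_mem_prod hu ht)).comp u hc (fun w hw ↦ mk_mem_prod hw ht)
    exact h.hasFDerivAt (hB.mem_nhds hu)
  -- the `t`-partial at `t₀` is `Y ∘ Ψ` on `B` (uniqueness of derivatives within `S'`)
  have hpt : ∀ u ∈ B, fderivWithin ℝ Ψ Q (u, t₀) ((0 : F₁), (1 : ℝ)) = Y (Ψ (u, t₀)) :=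
    fun u hu ↦ (hS' t₀ ht₀).eq_deriv _ (hslice_t u hu t₀ ht₀) (hode u hu)
  -- the `u`-partial is the slice derivative
  have hfd_u : ∀ u ∈ B, ∀ t ∈ S',
      fderiv ℝ (fun w ↦ Ψ (w, t)) u v = fderivWithin ℝ Ψ Q (u, t) (v, 0) := by
    intro u hu t ht
    rw [(hslice_u u hu t ht).fderiv]
    simp
  -- (a) `∂_t [∂_u Ψ (u₀, t) v] = D²Ψ (0, 1) (v, 0)`
  have ha : HasDerivWithinAt (fun t ↦ fderivWithin ℝ Ψ Q (u₀, t) (v, 0))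
      (D2 ((0 : F₁), (1 : ℝ)) (v, 0)) S' t₀ := by
    have hc : HasDerivWithinAt (fun s : ℝ ↦ (u₀, s)) ((0 : F₁), (1 : ℝ)) S' t₀ :=
      (hasDerivWithinAt_const _ _ _).prodMk (hasDerivWithinAt_id _ _)
    have h := hD2.comp_hasDerivWithinAt t₀ hc (fun s hs ↦ mk_mem_prod hu₀ hs)
    have h' := h.clm_apply (hasDerivWithinAt_const t₀ S' ((v, (0 : ℝ)) : F₁ × ℝ))
    refine h'.congr_deriv ?_
    simp
  -- (b) `∂_u [∂_t Ψ (u, t₀)] v = D²Ψ (v, 0) (0, 1) = DY (∂_u Ψ v)`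
  have hb : D2 (v, 0) ((0 : F₁), (1 : ℝ)) =
      fderiv ℝ Y (Ψ (u₀, t₀)) (fderivWithin ℝ Ψ Q (u₀, t₀) (v, 0)) := by
    -- derivative of `w ↦ fderivWithin Ψ Q (w, t₀)` at `u₀`
    have hc : HasFDerivWithinAt (fun w : F₁ ↦ (w, t₀)) (ContinuousLinearMap.inl ℝ F₁ ℝ) B u₀ :=
      (hasFDerivAt_prodMk_left u₀ t₀).hasFDerivWithinAt
    have h1 : HasFDerivAt (fun w ↦ fderivWithin ℝ Ψ Q (w, t₀))
        (D2.comp (ContinuousLinearMap.inl ℝ F₁ ℝ)) u₀ :=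
      (hD2.comp u₀ hc (fun w hw ↦ mk_mem_prod hw ht₀)).hasFDerivAt (hB.mem_nhds hu₀)
    have h2 : HasFDerivAt (fun w ↦ fderivWithin ℝ Ψ Q (w, t₀) ((0 : F₁), (1 : ℝ)))
        ((ContinuousLinearMap.apply ℝ F₂ ((0 : F₁), (1 : ℝ))).comp
          (D2.comp (ContinuousLinearMap.inl ℝ F₁ ℝ))) u₀ :=
      (ContinuousLinearMap.apply ℝ F₂ ((0 : F₁), (1 : ℝ))).hasFDerivAt.comp u₀ h1
    -- the same function is `Y ∘ Ψ(·, t₀)` near `u₀`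
    have h3 : HasFDerivAt (fun w ↦ Y (Ψ (w, t₀)))
        ((fderiv ℝ Y (Ψ (u₀, t₀))).comp
          ((fderivWithin ℝ Ψ Q (u₀, t₀)).comp (ContinuousLinearMap.inl ℝ F₁ ℝ))) u₀ :=
      hY.hasFDerivAt.comp u₀ (hslice_u u₀ hu₀ t₀ ht₀)
    have h4 : HasFDerivAt (fun w ↦ fderivWithin ℝ Ψ Q (w, t₀) ((0 : F₁), (1 : ℝ)))
        ((fderiv ℝ Y (Ψ (u₀, t₀))).comp
          ((fderivWithin ℝ Ψ Q (u₀, t₀)).comp (ContinuousLinearMap.inl ℝ F₁ ℝ))) u₀ := by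
      refine h3.congr_of_eventuallyEq ?_
      filter_upwards [hB.mem_nhds hu₀] with w hw
      exact hpt w hw
    have h5 := h2.unique h4
    have := congrArg (fun L : F₁ →L[ℝ] F₂ ↦ L v) h5
    simpa using this
  -- (c) symmetry, and conclusion
  have hc : D2 ((0 : F₁), (1 : ℝ)) (v, 0) = D2 (v, 0) ((0 : F₁), (1 : ℝ)) := hsymm.eq _ _
  have key : HasDerivWithinAt (fun t ↦ fderivWithin ℝ Ψ Q (u₀, t) (v, 0))
      (fderiv ℝ Y (Ψ (u₀, t₀)) (fderiv ℝ (fun u ↦ Ψ (u, t₀)) u₀ v)) S' t₀ := by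
    rw [hfd_u u₀ hu₀ t₀ ht₀, ← hb, ← hc]
    exact ha
  refine key.congr_of_eventuallyEq ?_ (hfd_u u₀ hu₀ t₀ ht₀)
  filter_upwards [self_mem_nhdsWithin] with t ht
  exact hfd_u u₀ hu₀ t ht

end Calculus

/-! ### Families and maps read in charts -/

section Charts

variable {E : Type*} [NormedAddCommGroup E] [NormedSpace ℝ E] {H : Type*} [TopologicalSpace H]
  {I : ModelWithCorners ℝ E H} {M : Type*} [TopologicalSpace M] [ChartedSpace H M]
  [IsManifold I ∞ M]
  {E' : Type*} [NormedAddCommGroup E'] [NormedSpace ℝ E'] {H' : Type*} [TopologicalSpace H']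
  {I' : ModelWithCorners ℝ E' H'} {N : Type*} [TopologicalSpace N] [ChartedSpace H' N]
  [IsManifold I' ∞ N]

set_option maxSynthPendingDepth 2 in
-- nested operator spaces `E →L E →L ℝ` over the tangent fibres
/-- **The components of a `C^∞` family of metrics in the coordinate frame of the chart at `x₀` are
`C^∞` on `(chart domain) × S`**: the family map `(y, s) ↦ (y, g_s(y))` read in the trivialization of
the bundle of bilinear forms at `x₀` (`Trivialization.contMDiffOn_iff`, `trivializationAt_bilin_snd`).
[folklore] -/
theorem IsContMDiffFamilyOn.contMDiffOn_bilinInChart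
    {g : ℝ → PseudoRiemannianMetric I ∞ E (TangentSpace I : M → Type _)} {S : Set ℝ}
    (hg : IsContMDiffFamilyOn ∞ g S) (x₀ : M) :
    ContMDiffOn (I.prod 𝓘(ℝ, ℝ)) 𝓘(ℝ, E →L[ℝ] E →L[ℝ] ℝ) ∞
      (fun q : M × ℝ ↦ bilinInChart (g q.2) x₀ q.1) ((chartAt H x₀).source ×ˢ S) := by
  set e := trivializationAt (E →L[ℝ] E →L[ℝ] ℝ)
    (fun b : M ↦ TangentSpace I b →L[ℝ] TangentSpace I b →L[ℝ] ℝ) x₀ with he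
  have hmem : ∀ y ∈ (chartAt H x₀).source, y ∈ e.baseSet := by
    intro y hy
    rw [he, hom_trivializationAt_baseSet, hom_trivializationAt_baseSet,
      TangentBundle.trivializationAt_baseSet]
    exact ⟨hy, hy, mem_univ _⟩
  have hmaps : MapsTo (fun q : M × ℝ ↦ TotalSpace.mk' (E →L[ℝ] E →L[ℝ] ℝ)
      (E := fun b : M ↦ TangentSpace I b →L[ℝ] TangentSpace I b →L[ℝ] ℝ) q.1 ((g q.2).val q.1))
      ((chartAt H x₀).source ×ˢ S) e.source := by
    intro q hq
    rw [e.mem_source]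
    exact hmem q.1 hq.1
  have h := ((e.contMDiffOn_iff hmaps).1
    (ContMDiffOn.mono hg (prod_mono (subset_univ _) Subset.rfl))).2
  refine h.congr fun q hq ↦ ?_
  have hy' : q.1 ∈ (trivializationAt E (TangentSpace I) x₀).baseSet := by
    rw [TangentBundle.trivializationAt_baseSet]; exact hq.1
  exact (trivializationAt_bilin_snd x₀ hy' ((g q.2).val q.1)).symm

/-- **A `C^∞` family of metrics read in a chart is `C^∞` on `(chart target) × S`.** For
`IsContMDiffFamilyOn ∞ g S` and the chart of `M` at `x₀`, the map
`(z, s) ↦ metricInChart (g s) x₀ z` (the components of `g_s` at `φ⁻¹ z` in the coordinate frame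
of the chart at `x₀`) is `C^∞` on `φ.target × S` as a map of normed spaces
(`contMDiffOn_bilinInChart` read in the chart `φ × id` of `M × ℝ`, `contMDiffOn_iff`).
[folklore] -/
theorem IsContMDiffFamilyOn.contDiffOn_metricInChart
    {g : ℝ → PseudoRiemannianMetric I ∞ E (TangentSpace I : M → Type _)} {S : Set ℝ}
    (hg : IsContMDiffFamilyOn ∞ g S) (x₀ : M) :
    ContDiffOn ℝ ∞ (fun q : E × ℝ ↦ metricInChart (g q.2) x₀ q.1)
      ((extChartAt I x₀).target ×ˢ S) := by
  have h1 := hg.contMDiffOn_bilinInChart x₀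
  -- read in the chart `φ × id` of `M × ℝ` at `(x₀, 0)`
  have key := (contMDiffOn_iff.1 h1).2 (x₀, 0) (bilinInChart (g 0) x₀ x₀)
  set V : Set E := (extChartAt I x₀).target ∩ (extChartAt I x₀).symm ⁻¹' (chartAt H x₀).source
    with hVdef
  have hV : V = (extChartAt I x₀).target := by
    refine inter_eq_left.2 fun z hz ↦ ?_
    rw [mem_preimage, ← extChartAt_source I]
    exact (extChartAt I x₀).map_target hz
  have hset : (extChartAt (I.prod 𝓘(ℝ, ℝ)) (x₀, (0 : ℝ))).target ∩
      (extChartAt (I.prod 𝓘(ℝ, ℝ)) (x₀, (0 : ℝ))).symm ⁻¹'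
        ((chartAt H x₀).source ×ˢ S ∩ (fun q : M × ℝ ↦ bilinInChart (g q.2) x₀ q.1) ⁻¹'
          (extChartAt 𝓘(ℝ, E →L[ℝ] E →L[ℝ] ℝ) (bilinInChart (g 0) x₀ x₀)).source) = V ×ˢ S := by
    ext ⟨z, s⟩
    simp only [extChartAt_prod, PartialEquiv.prod_target, PartialEquiv.prod_symm,
      PartialEquiv.prod_coe, extChartAt_model_space_eq_id, PartialEquiv.refl_target,
      PartialEquiv.refl_symm, PartialEquiv.refl_coe, PartialEquiv.refl_source, preimage_univ,
      inter_univ, mem_inter_iff, mem_prod, mem_univ, and_true, mem_preimage, hVdef, id]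
    tauto
  have hfun : ∀ q : E × ℝ, ((extChartAt 𝓘(ℝ, E →L[ℝ] E →L[ℝ] ℝ) (bilinInChart (g 0) x₀ x₀)) ∘
      (fun q : M × ℝ ↦ bilinInChart (g q.2) x₀ q.1) ∘
        (extChartAt (I.prod 𝓘(ℝ, ℝ)) (x₀, (0 : ℝ))).symm) q = metricInChart (g q.2) x₀ q.1 := by
    intro q
    simp only [comp_apply, extChartAt_model_space_eq_id, PartialEquiv.refl_coe, id_eq,
      extChartAt_prod_real_symm_apply]
    rfl
  rw [hset, hV] at key
  exact key.congr fun q _ ↦ (hfun q).symm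

/-- **A family of maps read in charts.** If `(u, t) ↦ ψ_t u` is `C^n` on `N × S` (as a map on
the product manifold), then its expression `Ψ̂(û, t) = φ(ψ_t(φ_N⁻¹ û))` in the charts `φ_N` of
`N` at `u₀` and `φ` of `M` at `x₀` is `C^n` on the set of `(û, t) ∈ φ_N.target × S` with
`ψ_t(φ_N⁻¹ û)` in the domain of `φ` (`contMDiffOn_iff` with the chart `φ_N × id` of `N × ℝ`).
[folklore] -/
theorem contDiffOn_uncurry_chart {ψ : ℝ → N → M} {S : Set ℝ}
    (hψ : ContMDiffOn (I'.prod 𝓘(ℝ, ℝ)) I ∞ (fun q : N × ℝ ↦ ψ q.2 q.1) (univ ×ˢ S))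
    (u₀ : N) (x₀ : M) :
    ContDiffOn ℝ ∞ (fun q : E' × ℝ ↦ extChartAt I x₀ (ψ q.2 ((extChartAt I' u₀).symm q.1)))
      (((extChartAt I' u₀).target ×ˢ S) ∩
        {q | ψ q.2 ((extChartAt I' u₀).symm q.1) ∈ (extChartAt I x₀).source}) := by
  have key := (contMDiffOn_iff.1 hψ).2 (u₀, 0) x₀
  have hset : (extChartAt (I'.prod 𝓘(ℝ, ℝ)) (u₀, (0 : ℝ))).target ∩
      (extChartAt (I'.prod 𝓘(ℝ, ℝ)) (u₀, (0 : ℝ))).symm ⁻¹'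
        (univ ×ˢ S ∩ (fun q : N × ℝ ↦ ψ q.2 q.1) ⁻¹' (extChartAt I x₀).source) =
      ((extChartAt I' u₀).target ×ˢ S) ∩
        {q | ψ q.2 ((extChartAt I' u₀).symm q.1) ∈ (extChartAt I x₀).source} := by
    ext ⟨z, s⟩
    simp only [extChartAt_prod, PartialEquiv.prod_target, PartialEquiv.prod_symm,
      PartialEquiv.prod_coe, extChartAt_model_space_eq_id, PartialEquiv.refl_target,
      PartialEquiv.refl_symm, PartialEquiv.refl_coe, mem_inter_iff, mem_prod, mem_univ, and_true,
      mem_preimage, true_and, mem_setOf_eq, id]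
    tauto
  have hfun : ∀ q : E' × ℝ, ((extChartAt I x₀) ∘ (fun q : N × ℝ ↦ ψ q.2 q.1) ∘
      (extChartAt (I'.prod 𝓘(ℝ, ℝ)) (u₀, (0 : ℝ))).symm) q =
        extChartAt I x₀ (ψ q.2 ((extChartAt I' u₀).symm q.1)) := by
    intro q
    simp only [comp_apply, extChartAt_prod_real_symm_apply]
  rw [hset] at key
  exact key.congr fun q _ ↦ (hfun q).symm

omit [IsManifold I' ∞ N] in
/-- Bridge to `TimeDependentIntegralCurve.lean`: the chart expression of the time slice `Y t` of a
time-dependent field (`vectorInChart`, `LieDerivMetricChart.lean`) is `fieldInChart Y x₀ t`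
(definitionally). [folklore] -/
theorem vectorInChart_eq_fieldInChart (x₀ : M) (Y : ℝ → Π x : M, TangentSpace I x)
    (t : ℝ) : vectorInChart x₀ (Y t) = fieldInChart Y x₀ t := rfl

variable [I'.Boundaryless]

omit [IsManifold I' ∞ N] in
/-- **The differential read in tangent coordinates is the derivative of the chart expression.**
For `f : N → M` differentiable at `u` with `f u` in the chart domain of `x₀` (boundaryless `N`):
`τ_{f u} (df_u v) = D(φ ∘ f ∘ φ_N⁻¹)(φ_N u) v`, where `τ` is the trivialization of `TM` at `x₀`,
`φ = extChartAt I x₀` and `φ_N = extChartAt I' u` (chain rule; `dφ_N|_u = id`).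
[folklore] -/
theorem continuousLinearMapAt_mfderiv_eq_fderiv {f : N → M} {u : N} {x₀ : M}
    (hf : MDifferentiableAt I' I f u) (hfu : f u ∈ (chartAt H x₀).source) (v : TangentSpace I' u) :
    (trivializationAt E (TangentSpace I) x₀).continuousLinearMapAt ℝ (f u) (mfderiv I' I f u v) =
      fderiv ℝ (extChartAt I x₀ ∘ f ∘ (extChartAt I' u).symm) (extChartAt I' u u) v := by
  have hφ : MDifferentiableAt I 𝓘(ℝ, E) (extChartAt I x₀) (f u) := mdifferentiableAt_extChartAt hfu
  have hcomp : MDifferentiableAt I' 𝓘(ℝ, E) (extChartAt I x₀ ∘ f) u := hφ.comp u hf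
  rw [TangentBundle.continuousLinearMapAt_trivializationAt hfu, ← comp_assoc,
    ← mvfderiv_eq_fderiv_extChartAt hcomp]
  simp only [mvfderiv, ContinuousLinearMap.coe_comp, comp_apply]
  rw [mfderiv_comp u hφ hf]
  rfl

end Charts

/-! ### The pulled-back family is smooth jointly in space and time -/

section PullbackSmooth

variable {B : Type*} [TopologicalSpace B] {F : Type*} [NormedAddCommGroup F] [NormedSpace ℝ F]
  {V : B → Type*} [TopologicalSpace (TotalSpace F V)] [∀ b, TopologicalSpace (V b)]
  [∀ b, AddCommGroup (V b)] [∀ b, Module ℝ (V b)] [FiberBundle F V] [VectorBundle ℝ F V]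
  {EX : Type*} [NormedAddCommGroup EX] [NormedSpace ℝ EX] {HX : Type*} [TopologicalSpace HX]
  {IX : ModelWithCorners ℝ EX HX} {Xm : Type*} [TopologicalSpace Xm] [ChartedSpace HX Xm]
  {EB : Type*} [NormedAddCommGroup EB] [NormedSpace ℝ EB] {HB : Type*} [TopologicalSpace HB]
  {IB : ModelWithCorners ℝ EB HB} [ChartedSpace HB B] {k : ℕ∞ω}

/-- Within-a-set version of `contMDiffAt_bilin_iff` (`IsometryProofs.lean`): a map
`x ↦ (b x, s x)` into the bundle of bilinear forms on `V` is `C^k` within `A` at `x₀` iff the base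
map is and the coordinate expression `x ↦ ((e, e') ↦ s x (τ⁻¹ e) (τ⁻¹ e'))`, `τ` the trivialization
of `V` at `b x₀`, is `C^k` within `A` at `x₀` as a map into `F →L F →L ℝ`. [folklore] -/
theorem contMDiffWithinAt_bilin_iff {b : Xm → B} {s : ∀ x, V (b x) →L[ℝ] V (b x) →L[ℝ] ℝ}
    {A : Set Xm} {x₀ : Xm} :
    ContMDiffWithinAt IX (IB.prod 𝓘(ℝ, F →L[ℝ] F →L[ℝ] ℝ)) k
        (fun x ↦ TotalSpace.mk' (F →L[ℝ] F →L[ℝ] ℝ) (E := fun b ↦ V b →L[ℝ] V b →L[ℝ] ℝ)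
          (b x) (s x)) A x₀ ↔
      ContMDiffWithinAt IX IB k b A x₀ ∧
        ContMDiffWithinAt IX 𝓘(ℝ, F →L[ℝ] F →L[ℝ] ℝ) k
          (fun x ↦ (ContinuousLinearMap.precomp ℝ ((trivializationAt F V (b x₀)).symmL ℝ (b x))).comp
            ((s x).comp ((trivializationAt F V (b x₀)).symmL ℝ (b x)))) A x₀ := by
  rw [contMDiffWithinAt_totalSpace]
  refine and_congr_right fun hb ↦ ?_
  dsimp only [TotalSpace.mk']
  have hev : ∀ᶠ x in 𝓝[A] x₀, b x ∈ (trivializationAt F V (b x₀)).baseSet :=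
    hb.continuousWithinAt.preimage_mem_nhdsWithin
      ((trivializationAt F V (b x₀)).open_baseSet.mem_nhds
        (FiberBundle.mem_baseSet_trivializationAt' (b x₀)))
  refine Filter.EventuallyEq.contMDiffWithinAt_iff (hev.mono fun x hx ↦ ?_) ?_
  · exact trivializationAt_bilin_snd (b x₀) hx (s x)
  · exact trivializationAt_bilin_snd (b x₀) (FiberBundle.mem_baseSet_trivializationAt' (b x₀)) (s x₀)

variable {E : Type*} [NormedAddCommGroup E] [NormedSpace ℝ E] {H : Type*} [TopologicalSpace H]
  {I : ModelWithCorners ℝ E H} {M : Type*} [TopologicalSpace M] [ChartedSpace H M]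
  [IsManifold I ∞ M]
  {E' : Type*} [NormedAddCommGroup E'] [NormedSpace ℝ E'] {H' : Type*} [TopologicalSpace H']
  {I' : ModelWithCorners ℝ E' H'} {N : Type*} [TopologicalSpace N] [ChartedSpace H' N]
  [IsManifold I' ∞ N]

set_option maxSynthPendingDepth 2 in
-- nested operator spaces `E →L E →L ℝ` over the tangent fibres
/-- **The pullback of a smooth family of metrics along a smooth family of maps is a smooth
family** (the parametric form of `contMDiff_pullbackBilin_holds`, `IsometryProofs.lean`;
O'Neill 1983, Ch. 3, Def. 3.9: `f^* g = (Df)ᵀ (g ∘ f) Df` in charts). If `(x, t) ↦ g_t(x)` is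
`C^∞` on `M × S` (`IsContMDiffFamilyOn ∞ g S`) and `(u, t) ↦ ψ_t u` is `C^∞` on `N × S`, then
`(u, t) ↦ (ψ_t^* g_t)_u` (`pullbackBilin (ψ t) (g t).val u`, `Isometry.lean`) is `C^∞` on
`N × S` as a map into the bundle of bilinear forms on `TN`. In tangent coordinates at
`(u₀, ψ_{t₀} u₀)`: the differential `(u, t) ↦ dψ_t|_u` is `C^∞` within `N × S`
(Mathlib's `ContMDiffWithinAt.mfderivWithin`, the derivative of a parametrised family), the metric
components along `(u, t) ↦ (ψ_t u, t)` are `C^∞` (`IsContMDiffFamilyOn.contMDiffOn_bilinInChart`),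
and `ψ_t^* g_t = (Dψ_t)ᵀ (g_t ∘ ψ_t) Dψ_t`. This is the smoothness clause of the Ricci flow
`ψ_t^* g_t` in Topping 2006, §5.2, Step 2 (iii)–(iv). [cite: ONeill1983, Ch. 3, Def. 3.9]
[cite: Topping2006, §5.2, Step 2] -/
theorem IsContMDiffFamilyOn.pullbackBilin
    {g : ℝ → PseudoRiemannianMetric I ∞ E (TangentSpace I : M → Type _)} {S : Set ℝ}
    (hg : IsContMDiffFamilyOn ∞ g S) {ψ : ℝ → N → M}
    (hψ : ContMDiffOn (I'.prod 𝓘(ℝ, ℝ)) I ∞ (fun q : N × ℝ ↦ ψ q.2 q.1) (univ ×ˢ S)) :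
    ContMDiffOn (I'.prod 𝓘(ℝ, ℝ)) (I'.prod 𝓘(ℝ, E' →L[ℝ] E' →L[ℝ] ℝ)) ∞
      (fun p : N × ℝ ↦ TotalSpace.mk' (E' →L[ℝ] E' →L[ℝ] ℝ)
        (E := fun b : N ↦ TangentSpace I' b →L[ℝ] TangentSpace I' b →L[ℝ] ℝ) p.1
        (pullbackBilin (I := I) (I' := I') (ψ p.2) (g p.2).val p.1)) (univ ×ˢ S) := by
  rintro ⟨u₀, t₀⟩ hp₀
  have ht₀ : t₀ ∈ S := hp₀.2
  rw [contMDiffWithinAt_bilin_iff]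
  refine ⟨contMDiffWithinAt_fst, ?_⟩
  set x₀ : M := ψ t₀ u₀ with hx₀
  set τN := trivializationAt E' (TangentSpace I' : N → Type _) u₀ with hτN
  set τM := trivializationAt E (TangentSpace I : M → Type _) x₀ with hτM
  -- `Φ p = τM ∘ D(ψ_t)_u ∘ τN⁻¹`, `C^∞` within `N × S` at `(u₀, t₀)`
  set Φ : N × ℝ → E' →L[ℝ] E := inTangentCoordinates I' I (fun p : N × ℝ ↦ p.1)
    (fun p : N × ℝ ↦ ψ p.2 p.1) (fun p : N × ℝ ↦ mfderiv I' I (ψ p.2) p.1) (u₀, t₀) with hΦ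
  have hΦs : ContMDiffWithinAt (I'.prod 𝓘(ℝ, ℝ)) 𝓘(ℝ, E' →L[ℝ] E) ∞ Φ (univ ×ˢ S) (u₀, t₀) := by
    have hf : ContMDiffWithinAt ((I'.prod 𝓘(ℝ, ℝ)).prod I') I ∞
        (Function.uncurry fun (p : N × ℝ) (y : N) ↦ ψ p.2 y) ((univ ×ˢ S) ×ˢ univ)
        ((u₀, t₀), u₀) := by
      have h1 : ContMDiffWithinAt (I'.prod 𝓘(ℝ, ℝ)) I ∞ (fun q : N × ℝ ↦ ψ q.2 q.1) (univ ×ˢ S)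
          (u₀, t₀) := hψ (u₀, t₀) hp₀
      have h2 : ContMDiffWithinAt ((I'.prod 𝓘(ℝ, ℝ)).prod I') (I'.prod 𝓘(ℝ, ℝ)) ∞
          (fun r : (N × ℝ) × N ↦ ((r.2, r.1.2) : N × ℝ)) ((univ ×ˢ S) ×ˢ univ) ((u₀, t₀), u₀) :=
        contMDiffWithinAt_snd.prodMk (contMDiffWithinAt_snd.comp _ contMDiffWithinAt_fst
          (mapsTo_univ _ _))
      exact h1.comp_of_eq h2 (fun r hr ↦ mk_mem_prod (mem_univ _) hr.1.2) rfl
    have h := ContMDiffWithinAt.mfderivWithin (m := ∞) hf contMDiffWithinAt_fst hp₀ (mapsTo_univ _ _)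
      (by exact_mod_cast le_top) uniqueMDiffOn_univ
    simp only [mfderivWithin_univ] at h
    exact h
  -- the metric components along `(u, t) ↦ (ψ_t u, t)`, `C^∞` within `N × S` at `(u₀, t₀)`
  set β : M × ℝ → E →L[ℝ] E →L[ℝ] ℝ := fun q ↦ bilinInChart (g q.2) x₀ q.1 with hβ
  have hβψ : ContMDiffWithinAt (I'.prod 𝓘(ℝ, ℝ)) 𝓘(ℝ, E →L[ℝ] E →L[ℝ] ℝ) ∞
      (β ∘ fun p : N × ℝ ↦ ((ψ p.2 p.1, p.2) : M × ℝ)) (univ ×ˢ S) (u₀, t₀) := by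
    have hβs : ContMDiffWithinAt (I.prod 𝓘(ℝ, ℝ)) 𝓘(ℝ, E →L[ℝ] E →L[ℝ] ℝ) ∞ β
        ((chartAt H x₀).source ×ˢ S) (x₀, t₀) :=
      hg.contMDiffOn_bilinInChart x₀ (x₀, t₀) (mk_mem_prod (mem_chart_source H x₀) ht₀)
    have hin : ContMDiffWithinAt (I'.prod 𝓘(ℝ, ℝ)) (I.prod 𝓘(ℝ, ℝ)) ∞
        (fun p : N × ℝ ↦ ((ψ p.2 p.1, p.2) : M × ℝ)) (univ ×ˢ S) (u₀, t₀) :=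
      (hψ (u₀, t₀) hp₀).prodMk contMDiffWithinAt_snd
    have hpre : (fun p : N × ℝ ↦ ((ψ p.2 p.1, p.2) : M × ℝ)) ⁻¹' ((chartAt H x₀).source ×ˢ S) ∈
        𝓝[univ ×ˢ S] (u₀, t₀) := by
      have h1 : (fun p : N × ℝ ↦ ψ p.2 p.1) ⁻¹' (chartAt H x₀).source ∈ 𝓝[univ ×ˢ S] (u₀, t₀) :=
        (hψ (u₀, t₀) hp₀).continuousWithinAt.preimage_mem_nhdsWithin
          ((chartAt H x₀).open_source.mem_nhds (mem_chart_source H x₀))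
      filter_upwards [h1, self_mem_nhdsWithin] with p hp hpS
      exact mk_mem_prod hp hpS.2
    have h := hβs.comp_of_eq (hin.mono (inter_subset_left (t := (fun p : N × ℝ ↦
      ((ψ p.2 p.1, p.2) : M × ℝ)) ⁻¹' ((chartAt H x₀).source ×ˢ S)))) (fun p hp ↦ hp.2) rfl
    exact h.mono_of_mem_nhdsWithin (inter_mem self_mem_nhdsWithin hpre)
  -- the composite `p ↦ (Φ p)ᵀ (β (ψ p)) (Φ p)` is `C^∞` within `N × S` at `(u₀, t₀)`
  have h1 : ContMDiffWithinAt (I'.prod 𝓘(ℝ, ℝ)) 𝓘(ℝ, E' →L[ℝ] E →L[ℝ] ℝ) ∞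
      (fun p : N × ℝ ↦ (β (ψ p.2 p.1, p.2)).comp (Φ p)) (univ ×ˢ S) (u₀, t₀) :=
    hβψ.clm_comp hΦs
  have h2 : ContMDiffWithinAt (I'.prod 𝓘(ℝ, ℝ)) 𝓘(ℝ, (E →L[ℝ] ℝ) →L[ℝ] (E' →L[ℝ] ℝ)) ∞
      (fun p : N × ℝ ↦ (Φ p).precomp ℝ) (univ ×ˢ S) (u₀, t₀) :=
    hΦs.clm_precomp (F₃ := ℝ)
  have hcomp : ContMDiffWithinAt (I'.prod 𝓘(ℝ, ℝ)) 𝓘(ℝ, E' →L[ℝ] E' →L[ℝ] ℝ) ∞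
      (fun p : N × ℝ ↦ ((Φ p).precomp ℝ).comp ((β (ψ p.2 p.1, p.2)).comp (Φ p))) (univ ×ˢ S)
      (u₀, t₀) :=
    h2.clm_comp h1
  -- which agrees with the coordinate expression of the pulled-back family near `(u₀, t₀)`
  refine hcomp.congr_of_eventuallyEq_of_mem ?_ hp₀
  have hev : ∀ᶠ p in 𝓝[univ ×ˢ S] ((u₀, t₀) : N × ℝ), ψ p.2 p.1 ∈ τM.baseSet :=
    (hψ (u₀, t₀) hp₀).continuousWithinAt.preimage_mem_nhdsWithin
      (τM.open_baseSet.mem_nhds (FiberBundle.mem_baseSet_trivializationAt' x₀))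
  filter_upwards [hev] with p hfy
  ext e e'
  have key : ∀ a : E', (trivializationAt E (TangentSpace I : M → Type _) x₀).symmL ℝ (ψ p.2 p.1)
      (Φ p a) = mfderiv I' I (ψ p.2) p.1
        ((trivializationAt E' (TangentSpace I' : N → Type _) u₀).symmL ℝ p.1 a) := by
    intro a
    simp only [hΦ, inTangentCoordinates, ContinuousLinearMap.inCoordinates,
      ContinuousLinearMap.coe_comp, comp_apply]
    exact τM.symmL_continuousLinearMapAt hfy _
  simp only [ContinuousLinearMap.coe_comp, comp_apply, ContinuousLinearMap.precomp_apply,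
    pullbackBilin_apply, hβ, bilinInChart_apply, key]

end PullbackSmooth

/-! ### Topping's Proposition 1.2.1 -/

section PullbackFamily

variable {E : Type*} [NormedAddCommGroup E] [NormedSpace ℝ E] {H : Type*} [TopologicalSpace H]
  {I : ModelWithCorners ℝ E H} {M : Type*} [TopologicalSpace M] [ChartedSpace H M]
  [IsManifold I ∞ M] [I.Boundaryless] [FiniteDimensional ℝ E] [CompleteSpace E]
  {E' : Type*} [NormedAddCommGroup E'] [NormedSpace ℝ E'] {H' : Type*} [TopologicalSpace H']
  {I' : ModelWithCorners ℝ E' H'} {N : Type*} [TopologicalSpace N] [ChartedSpace H' N]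
  [IsManifold I' ∞ N] [I'.Boundaryless]

set_option maxSynthPendingDepth 2 in
-- nested operator spaces `E →L E →L ℝ` (compare Mathlib's `Analysis/Normed/Operator/Bilinear.lean`)
/-- **Topping 2006, Prop. 1.2.1 (with `σ ≡ 1`), pointwise and within the time set**:
`∂_t (ψ_t^* g_t) = ψ_t^*(∂_t g_t + ℒ_{X_t} g_t)` ((1.2.3); "`X(t)` a time dependent family of
smooth vector fields generating a family of diffeomorphisms `ψ_t`", (1.2.1)). Data: a family of
`C^∞` metrics `g` on `M`, `C^∞` jointly on `M × S` (`IsContMDiffFamilyOn ∞ g S`); a time `t₀ ∈ S`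
at which `S` has unique one-sided derivatives and which lies in the closure of the interior of
`S` (any point of an interval with non-empty interior, e.g. `t₀ = 0 ∈ S = [0, ε]`); the time
derivative `h x A B` of `s ↦ g_s(x)(A, B)` at `t₀` within `S`; a Levi-Civita connection `cov` of
`g t₀`; a time-dependent vector field `X` with `X t₀` differentiable; and maps `ψ t : N → M`
with `(u, t) ↦ ψ_t u` of class `C^∞` on `N × S` whose orbits `t ↦ ψ_t u'` are integral curves of
`X` on `S` (`IsTimeDepMIntegralCurveOn`, one-sided at boundary times). Then for `u ∈ N` and
`v, w ∈ T_u N`, writing `V = dψ_{t₀} v`, `W = dψ_{t₀} w`, the function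
`t ↦ (ψ_t^* g_t)_u(v, w) = g_t(ψ_t u)(dψ_t v, dψ_t w)` has derivative
`h (ψ_{t₀} u) V W + ℒ_{X_{t₀}} g_{t₀} (ψ_{t₀} u)(V, W)` at `t₀` within `S`, where
`ℒ_X g (A, B) = g(∇_A X, B) + g(A, ∇_B X)` (`lieDerivMetric`; Topping (2.3.8)). Proof in the
module docstring (charts at `ψ_{t₀} u` and `u`, product/chain rules within `S`, the symmetry of
second derivatives within `(ball) × S` for `V̂' = DX̂ V̂`, and `lieDerivMetric_eq_chart`).
[cite: Topping2006, §1.2.2, Prop. 1.2.1, (1.2.3)] -/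
theorem hasDerivWithinAt_val_pullback_family
    {g : ℝ → PseudoRiemannianMetric I ∞ E (TangentSpace I : M → Type _)}
    {cov : CovariantDerivative I E (TangentSpace I : M → Type _)}
    {X : ℝ → Π x : M, TangentSpace I x} {ψ : ℝ → N → M} {S : Set ℝ} {t₀ : ℝ}
    {h : Π x : M, TangentSpace I x → TangentSpace I x → ℝ}
    (hg : IsContMDiffFamilyOn ∞ g S) (hS : UniqueDiffOn ℝ S) (ht₀ : t₀ ∈ S)
    (ht₀' : t₀ ∈ closure (interior S))
    (hder : ∀ (x : M) (A B : TangentSpace I x),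
      HasDerivWithinAt (fun s ↦ (g s).val x A B) (h x A B) S t₀)
    (hLC : (g t₀).IsLeviCivita cov)
    (hψ : ContMDiffOn (I'.prod 𝓘(ℝ, ℝ)) I ∞ (fun q : N × ℝ ↦ ψ q.2 q.1) (univ ×ˢ S))
    (hode : ∀ u' : N, IsTimeDepMIntegralCurveOn (fun t ↦ ψ t u') X S)
    (u : N) (hXd : MDiffAt (T% (X t₀)) (ψ t₀ u)) (v w : TangentSpace I' u) :
    HasDerivWithinAt
      (fun t ↦ (g t).val (ψ t u) (mfderiv I' I (ψ t) u v) (mfderiv I' I (ψ t) u w))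
      (h (ψ t₀ u) (mfderiv I' I (ψ t₀) u v) (mfderiv I' I (ψ t₀) u w) +
        lieDerivMetric (g t₀) cov (X t₀) (ψ t₀ u)
          (mfderiv I' I (ψ t₀) u v) (mfderiv I' I (ψ t₀) u w)) S t₀ := by
  /- ─── notation ─── -/
  set x₀ : M := ψ t₀ u with hx₀_def
  set γ : ℝ → M := fun t ↦ ψ t u with hγ_def
  -- chart expressions (charts `extChartAt I x₀` of `M`, `extChartAt I' u` of `N`)
  set Gc : E × ℝ → E →L[ℝ] E →L[ℝ] ℝ := fun q ↦ metricInChart (g q.2) x₀ q.1 with hGc_def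
  set Ψc : E' × ℝ → E := fun q ↦ extChartAt I x₀ (ψ q.2 ((extChartAt I' u).symm q.1))
    with hΨc_def
  set Yc : E → E := vectorInChart x₀ (X t₀) with hYc_def
  set û₀ : E' := extChartAt I' u u with hû₀_def
  set z₀ : E := extChartAt I x₀ x₀ with hz₀_def
  set Vc : ℝ → E := fun t ↦ (trivializationAt E (TangentSpace I) x₀).continuousLinearMapAt ℝ (γ t)
    (mfderiv I' I (ψ t) u v) with hVc_def
  set Wc : ℝ → E := fun t ↦ (trivializationAt E (TangentSpace I) x₀).continuousLinearMapAt ℝ (γ t)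
    (mfderiv I' I (ψ t) u w) with hWc_def
  have hγt₀ : γ t₀ = x₀ := rfl
  have hx₀src : x₀ ∈ (chartAt H x₀).source := mem_chart_source H x₀
  have hx₀src' : x₀ ∈ (extChartAt I x₀).source := mem_extChartAt_source x₀
  have hz₀ : z₀ ∈ (extChartAt I x₀).target := mem_extChartAt_target x₀
  have hsymmû₀ : (extChartAt I' u).symm û₀ = u := extChartAt_to_inv u
  have hΨc₀ : Ψc (û₀, t₀) = z₀ := by
    simp only [hΨc_def, hsymmû₀]
    rfl
  /- ─── Step 0: neighbourhoods. `γ t ∈ chart domain` for `t ∈ S` near `t₀`; a ball `B ∋ û₀` and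
    an open `J ∋ t₀` such that `Ψ̂` takes values in the chart domain on `B × (S ∩ J)` ─── -/
  have hγcont : ContinuousWithinAt γ S t₀ := (hode u).continuousWithinAt ht₀
  have hγsrc : ∀ᶠ t in 𝓝[S] t₀, γ t ∈ (chartAt H x₀).source :=
    hγcont.preimage_mem_nhdsWithin ((chartAt H x₀).open_source.mem_nhds hx₀src)
  set A : Set (E' × ℝ) := ((extChartAt I' u).target ×ˢ S) ∩
    {q | ψ q.2 ((extChartAt I' u).symm q.1) ∈ (extChartAt I x₀).source} with hA_def
  have hΨc_smooth : ContDiffOn ℝ ∞ Ψc A := contDiffOn_uncurry_chart hψ u x₀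
  obtain ⟨B, J, hBopen, hû₀B, hJopen, ht₀J, hBJ⟩ : ∃ (B : Set E') (J : Set ℝ), IsOpen B ∧ û₀ ∈ B ∧
      IsOpen J ∧ t₀ ∈ J ∧ B ×ˢ (S ∩ J) ⊆ A := by
    -- continuity of `(û, t) ↦ ψ t (φN⁻¹ û)` within `φN.target × S` at `(û₀, t₀)`
    have hcont : ContinuousWithinAt (fun q : E' × ℝ ↦ ψ q.2 ((extChartAt I' u).symm q.1))
        ((extChartAt I' u).target ×ˢ S) (û₀, t₀) := by
      have h1 : ContinuousWithinAt (fun q : N × ℝ ↦ ψ q.2 q.1) (univ ×ˢ S) (u, t₀) :=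
        (hψ (u, t₀) (mk_mem_prod (mem_univ _) ht₀)).continuousWithinAt
      have h2 : ContinuousWithinAt (fun q : E' × ℝ ↦ (((extChartAt I' u).symm q.1, q.2) : N × ℝ))
          ((extChartAt I' u).target ×ˢ S) (û₀, t₀) :=
        ((continuousAt_extChartAt_symm u).comp_continuousWithinAt_of_eq continuousWithinAt_fst
          rfl).prodMk continuousWithinAt_snd
      have h3 : (((extChartAt I' u).symm û₀, t₀) : N × ℝ) = (u, t₀) := by rw [hsymmû₀]
      exact h1.comp_of_eq h2 (fun q hq ↦ mk_mem_prod (mem_univ _) hq.2) h3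
    have hpre : (fun q : E' × ℝ ↦ ψ q.2 ((extChartAt I' u).symm q.1)) ⁻¹' (extChartAt I x₀).source ∈
        𝓝[(extChartAt I' u).target ×ˢ S] (û₀, t₀) := by
      refine hcont.preimage_mem_nhdsWithin ?_
      have : ψ t₀ ((extChartAt I' u).symm û₀) = x₀ := by rw [hsymmû₀]
      rw [this]
      exact extChartAt_source_mem_nhds x₀
    have htarget : (extChartAt I' u).target ×ˢ (univ : Set ℝ) ∈ 𝓝 (û₀, t₀) :=
      prod_mem_nhds (extChartAt_target_mem_nhds u) univ_mem
    obtain ⟨O, hO, hOsub⟩ := mem_nhdsWithin_iff_exists_mem_nhds_inter.1 hpre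
    obtain ⟨B, hB, J, hJ, hBJsub⟩ := mem_nhds_prod_iff.1 (inter_mem hO htarget)
    obtain ⟨B', hB'B, hB'open, hû₀B'⟩ := mem_nhds_iff.1 hB
    obtain ⟨J', hJ'J, hJ'open, ht₀J'⟩ := mem_nhds_iff.1 hJ
    refine ⟨B', J', hB'open, hû₀B', hJ'open, ht₀J', ?_⟩
    rintro ⟨z, s⟩ ⟨hz, hs, hsJ⟩
    have hq : (z, s) ∈ O ∩ (extChartAt I' u).target ×ˢ (univ : Set ℝ) :=
      hBJsub (mk_mem_prod (hB'B hz) (hJ'J hsJ))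
    have hzT : z ∈ (extChartAt I' u).target := hq.2.1
    exact ⟨mk_mem_prod hzT hs, hOsub ⟨hq.1, mk_mem_prod hzT hs⟩⟩
  set S' : Set ℝ := S ∩ J with hS'_def
  have hS'S : S' ⊆ S := inter_subset_left
  have hS'uniq : UniqueDiffOn ℝ S' := hS.inter hJopen
  have ht₀S' : t₀ ∈ S' := ⟨ht₀, ht₀J⟩
  have ht₀S'c : t₀ ∈ closure (interior S') := mem_closure_interior_inter ht₀' hJopen ht₀J
  have hS'nhds : S' ∈ 𝓝[S] t₀ :=
    inter_mem self_mem_nhdsWithin (mem_nhdsWithin_of_mem_nhds (hJopen.mem_nhds ht₀J))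
  have hΨcQ : ContDiffOn ℝ ∞ Ψc (B ×ˢ S') := hΨc_smooth.mono hBJ
  have hmemA : ∀ z ∈ B, ∀ s ∈ S', ψ s ((extChartAt I' u).symm z) ∈ (chartAt H x₀).source := by
    intro z hz s hs
    have hq := hBJ (mk_mem_prod hz hs)
    rw [← extChartAt_source I]
    exact hq.2
  /- ─── Step 1: the integral-curve equation in the chart: `∂_t Ψ̂(z, t₀) = X̂_{t₀}(Ψ̂(z, t₀))` ─── -/
  have hode_chart : ∀ z ∈ B, HasDerivWithinAt (fun t ↦ Ψc (z, t)) (Yc (Ψc (z, t₀))) S' t₀ := by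
    intro z hz
    have hsrc : ψ t₀ ((extChartAt I' u).symm z) ∈ (chartAt H x₀).source := hmemA z hz t₀ ht₀S'
    have hsrc' : (fun t ↦ ψ t ((extChartAt I' u).symm z)) t₀ ∈ (extChartAt I x₀).source := by
      rwa [extChartAt_source]
    have hd := ((hode ((extChartAt I' u).symm z)).mono hS'S).hasDerivWithinAt ht₀S' hsrc'
    refine hd.congr_deriv ?_
    change tangentInChart x₀ (X t₀) (ψ t₀ ((extChartAt I' u).symm z)) =
      vectorInChart x₀ (X t₀) (extChartAt I x₀ (ψ t₀ ((extChartAt I' u).symm z)))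
    rw [tangentInChart_eq hsrc, vectorInChart_extChartAt hsrc]
  /- ─── Step 2: `V̂ t = ∂_u Ψ̂(û₀, t) v` on `S'`, and its derivative `DX̂ V̂` at `t₀` ─── -/
  have hslice : ∀ t ∈ S', MDifferentiableAt I' I (ψ t) u := by
    intro t ht
    have h1 : ContMDiffWithinAt (I'.prod 𝓘(ℝ, ℝ)) I ∞ (fun q : N × ℝ ↦ ψ q.2 q.1) (univ ×ˢ S)
        (u, t) := hψ (u, t) (mk_mem_prod (mem_univ _) (hS'S ht))
    have h2 : ContMDiffWithinAt I' I ∞ ((fun q : N × ℝ ↦ ψ q.2 q.1) ∘ fun u' : N ↦ (u', t))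
        univ u :=
      h1.comp u (contMDiffWithinAt_id.prodMk contMDiffWithinAt_const)
        (fun u' _ ↦ mk_mem_prod (mem_univ _) (hS'S ht))
    exact (contMDiffWithinAt_univ.1 h2).mdifferentiableAt (by simp)
  have hVc_eq : ∀ t ∈ S', ∀ v' : TangentSpace I' u,
      (trivializationAt E (TangentSpace I) x₀).continuousLinearMapAt ℝ (γ t)
        (mfderiv I' I (ψ t) u v') = fderiv ℝ (fun z ↦ Ψc (z, t)) û₀ v' := by
    intro t ht v'
    have hγsrc' : ψ t u ∈ (chartAt H x₀).source := by
      have := hmemA û₀ hû₀B t ht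
      rwa [hsymmû₀] at this
    exact continuousLinearMapAt_mfderiv_eq_fderiv (hslice t ht) hγsrc' v'
  have hYd₀ : DifferentiableAt ℝ Yc z₀ := differentiableAt_vectorInChart hXd
  have hYd : DifferentiableAt ℝ Yc (Ψc (û₀, t₀)) := hΨc₀ ▸ hYd₀
  have hVc' : ∀ v' : TangentSpace I' u, HasDerivWithinAt
      (fun t ↦ (trivializationAt E (TangentSpace I) x₀).continuousLinearMapAt ℝ (γ t)
        (mfderiv I' I (ψ t) u v'))
      (fderiv ℝ Yc z₀ ((trivializationAt E (TangentSpace I) x₀).continuousLinearMapAt ℝ (γ t₀)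
        (mfderiv I' I (ψ t₀) u v'))) S t₀ := by
    intro v'
    have key := hasDerivWithinAt_fderiv_slice hBopen hû₀B hS'uniq ht₀S' ht₀S'c
      (hΨcQ.of_le (WithTop.coe_le_coe.mpr le_top)) hode_chart hYd v'
    rw [hΨc₀] at key
    have key' : HasDerivWithinAt (fun t ↦ (trivializationAt E (TangentSpace I) x₀).continuousLinearMapAt
        ℝ (γ t) (mfderiv I' I (ψ t) u v'))
        (fderiv ℝ Yc z₀ (fderiv ℝ (fun z ↦ Ψc (z, t₀)) û₀ v')) S' t₀ := by
      refine key.congr_of_eventuallyEq ?_ (hVc_eq t₀ ht₀S' v')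
      filter_upwards [self_mem_nhdsWithin] with t ht
      exact hVc_eq t ht v'
    rw [← hVc_eq t₀ ht₀S' v'] at key'
    exact key'.mono_of_mem_nhdsWithin hS'nhds
  /- ─── Step 3: the metric family in the chart: derivative of `Ĝ` at `(z₀, t₀)` ─── -/
  have hGc_smooth : ContDiffOn ℝ ∞ Gc ((extChartAt I x₀).target ×ˢ S) :=
    hg.contDiffOn_metricInChart x₀
  obtain ⟨Gc', hGc'⟩ : ∃ Gc' : E × ℝ →L[ℝ] E →L[ℝ] E →L[ℝ] ℝ,
      HasFDerivWithinAt Gc Gc' ((extChartAt I x₀).target ×ˢ S) (z₀, t₀) :=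
    ⟨_, (hGc_smooth.differentiableOn (by simp) (z₀, t₀) (mk_mem_prod hz₀ ht₀)).hasFDerivWithinAt⟩
  have hGc_d' : HasFDerivWithinAt Gc Gc' (univ ×ˢ S) (z₀, t₀) := by
    refine hGc'.mono_of_mem_nhdsWithin ?_
    refine mem_nhdsWithin_iff_exists_mem_nhds_inter.2 ⟨(extChartAt I x₀).target ×ˢ univ,
      prod_mem_nhds (extChartAt_target_mem_nhds x₀) univ_mem, ?_⟩
    rintro ⟨z, s⟩ ⟨⟨hz, -⟩, -, hs⟩
    exact mk_mem_prod hz hs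
  -- the time partial of `Ĝ` is `h`
  have hGc_t : ∀ a b : E, Gc' ((0 : E), (1 : ℝ)) a b = h x₀ a b := by
    intro a b
    have hc : HasDerivWithinAt (fun s : ℝ ↦ (z₀, s)) ((0 : E), (1 : ℝ)) S t₀ :=
      (hasDerivWithinAt_const _ _ _).prodMk (hasDerivWithinAt_id _ _)
    have h1 := hGc_d'.comp_hasDerivWithinAt t₀ hc (fun s hs ↦ mk_mem_prod (mem_univ _) hs)
    have h2 : HasDerivWithinAt (fun s ↦ Gc (z₀, s) a b) (Gc' ((0 : E), (1 : ℝ)) a b) S t₀ := by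
      have := (h1.clm_apply (hasDerivWithinAt_const t₀ S a)).clm_apply
        (hasDerivWithinAt_const t₀ S b)
      refine this.congr_deriv ?_
      simp
    have h3 : HasDerivWithinAt (fun s ↦ Gc (z₀, s) a b) (h x₀ a b) S t₀ := by
      refine (hder x₀ a b).congr_of_eventuallyEq ?_ ?_
      · filter_upwards with s
        exact metricInChart_self (g s) x₀ a b
      · exact metricInChart_self (g t₀) x₀ a b
    exact (hS t₀ ht₀).eq_deriv _ h2 h3
  -- the space partial of `Ĝ` at `t₀` is the derivative of `metricInChart (g t₀) x₀`
  have hGc_z : ∀ e a b : E, Gc' (e, (0 : ℝ)) a b =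
      fderiv ℝ (fun z ↦ metricInChart (g t₀) x₀ z a b) z₀ e := by
    intro e a b
    have hc : HasFDerivWithinAt (fun z : E ↦ (z, t₀)) (ContinuousLinearMap.inl ℝ E ℝ) univ z₀ :=
      (hasFDerivAt_prodMk_left z₀ t₀).hasFDerivWithinAt
    have h0 : HasFDerivWithinAt (Gc ∘ fun z : E ↦ (z, t₀)) (Gc'.comp (ContinuousLinearMap.inl ℝ E ℝ))
        univ z₀ := hGc_d'.comp z₀ hc (fun z _ ↦ mk_mem_prod (mem_univ _) ht₀)
    have h1 : HasFDerivAt (metricInChart (g t₀) x₀) (Gc'.comp (ContinuousLinearMap.inl ℝ E ℝ)) z₀ :=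
      h0.hasFDerivAt univ_mem
    have h2 : fderiv ℝ (metricInChart (g t₀) x₀) z₀ = Gc'.comp (ContinuousLinearMap.inl ℝ E ℝ) :=
      h1.fderiv
    rw [fderiv_metricInChart_apply_apply (g t₀) x₀ hz₀, h2]
    simp
  /- ─── Step 4: the function in the chart, and the chain/product rule within `S` ─── -/
  set Fc : ℝ → ℝ := fun t ↦ Gc (extChartAt I x₀ (γ t), t) (Vc t) (Wc t) with hFc_def
  have hF_eq : ∀ t, γ t ∈ (chartAt H x₀).source →
      (g t).val (ψ t u) (mfderiv I' I (ψ t) u v) (mfderiv I' I (ψ t) u w) = Fc t := by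
    intro t hsrc
    have hb : γ t ∈ (trivializationAt E (TangentSpace I) x₀).baseSet := by
      rw [TangentBundle.trivializationAt_baseSet]; exact hsrc
    simp only [hFc_def, hGc_def, hVc_def, hWc_def]
    rw [metricInChart_extChartAt (g t) hsrc, bilinInChart_apply,
      Trivialization.symmL_continuousLinearMapAt _ hb,
      Trivialization.symmL_continuousLinearMapAt _ hb]
  -- derivative of `t ↦ φ (γ t)` within `S` at `t₀`
  have hγc : HasDerivWithinAt (fun t ↦ extChartAt I x₀ (γ t)) (Yc z₀) S t₀ := by
    have hd := (hode u).hasDerivWithinAt ht₀ (x₀ := x₀) hx₀src'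
    refine hd.congr_deriv ?_
    change tangentInChart x₀ (X t₀) x₀ = vectorInChart x₀ (X t₀) (extChartAt I x₀ x₀)
    rw [vectorInChart_extChartAt hx₀src, tangentInChart_eq hx₀src]
  have hpair : HasDerivWithinAt (fun t ↦ ((extChartAt I x₀ (γ t), t) : E × ℝ)) (Yc z₀, (1 : ℝ))
      S t₀ := hγc.prodMk (hasDerivWithinAt_id _ _)
  have hGγ : HasDerivWithinAt (Gc ∘ fun t ↦ ((extChartAt I x₀ (γ t), t) : E × ℝ))
      (Gc' (Yc z₀, (1 : ℝ))) S t₀ :=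
    hGc_d'.comp_hasDerivWithinAt_of_eq t₀ hpair (fun s hs ↦ mk_mem_prod (mem_univ _) hs) rfl
  have hFc : HasDerivWithinAt Fc
      (Gc' (Yc z₀, (1 : ℝ)) (Vc t₀) (Wc t₀) + Gc (z₀, t₀) (fderiv ℝ Yc z₀ (Vc t₀)) (Wc t₀) +
        Gc (z₀, t₀) (Vc t₀) (fderiv ℝ Yc z₀ (Wc t₀))) S t₀ := by
    have h1 := (hGγ.clm_apply (hVc' v)).clm_apply (hVc' w)
    refine h1.congr_deriv ?_
    simp only [comp_apply, _root_.add_apply, hVc_def, hWc_def, hγt₀, ← hz₀_def]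
  /- ─── Step 5: identification of the value of the derivative ─── -/
  have hcentre : ∀ v' : TangentSpace I' u,
      (trivializationAt E (TangentSpace I) x₀).continuousLinearMapAt ℝ (γ t₀)
        (mfderiv I' I (ψ t₀) u v') = mfderiv I' I (ψ t₀) u v' := by
    intro v'
    rw [hγt₀, TangentBundle.continuousLinearMapAt_trivializationAt hx₀src,
      mfderiv_extChartAt_self]
    rfl
  have hVc₀ : Vc t₀ = mfderiv I' I (ψ t₀) u v := hcentre v
  have hWc₀ : Wc t₀ = mfderiv I' I (ψ t₀) u w := hcentre w
  have hGc₀ : ∀ a b : E, Gc (z₀, t₀) a b = (g t₀).val x₀ a b := fun a b ↦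
    metricInChart_self (g t₀) x₀ a b
  have hYc₀ : Yc z₀ = X t₀ x₀ := vectorInChart_self x₀ (X t₀)
  have hsplit : ∀ a b : E, Gc' (Yc z₀, (1 : ℝ)) a b =
      h x₀ a b + fderiv ℝ (fun z ↦ metricInChart (g t₀) x₀ z a b) z₀ (X t₀ x₀) := by
    intro a b
    have : ((Yc z₀, (1 : ℝ)) : E × ℝ) = ((0 : E), (1 : ℝ)) + (Yc z₀, (0 : ℝ)) := by simp
    rw [this, map_add, _root_.add_apply, _root_.add_apply, hGc_t, hGc_z, hYc₀]
  have hLie := lieDerivMetric_eq_chart (g t₀) hLC hXd (mfderiv I' I (ψ t₀) u v)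
    (mfderiv I' I (ψ t₀) u w)
  have hval : Gc' (Yc z₀, (1 : ℝ)) (Vc t₀) (Wc t₀) + Gc (z₀, t₀) (fderiv ℝ Yc z₀ (Vc t₀)) (Wc t₀) +
        Gc (z₀, t₀) (Vc t₀) (fderiv ℝ Yc z₀ (Wc t₀)) =
      h x₀ (mfderiv I' I (ψ t₀) u v) (mfderiv I' I (ψ t₀) u w) +
        lieDerivMetric (g t₀) cov (X t₀) x₀ (mfderiv I' I (ψ t₀) u v) (mfderiv I' I (ψ t₀) u w) := by
    rw [hLie, hVc₀, hWc₀, hsplit, hGc₀, hGc₀]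
    ring
  rw [← hval]
  refine hFc.congr_of_eventuallyEq ?_ (hF_eq t₀ hx₀src)
  filter_upwards [hγsrc] with t hsrc
  exact hF_eq t hsrc

end PullbackFamily

end Literature.Geometry.Riemannian
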